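/-
Copyright (c) 2026 the pub-hodgecm-mathlib formalisation cell (harness21).  Prover seat hodgecm-mathlib-R90-C131-p02 (g2) = (TJ6) PEN on the S4 valve (dealer K2E2-plan (g8), S4-R59 (4) ∕
S4-R63 ∕ S4-R67 ∕ S4-R80), road (J̃♭) FILE (TJ6) «HERBRAND WINDOW», part 3a: THE INDEX IDENTITY `[K_W : cW] = [F_W : NW]` OF THE CAYLEY WINDOW (the `hidx` row of ★ FILE 3b).
Crux H413 `stmt-HodgeConjecture-24833`, lane `--supports … --as helper` (count-neutral).  THEOREMS ONLY (no `def`, no `instance`, no notation, no named-fact hypothesis, no `sorry`).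
-/
import Summits.HodgeConjecture.HodgeConjecture.Theorems.R90S4CayleyWindowDoubling     -- (TJ6) part 2c (this seat): `relIndex_sq_chart_eq_relIndex_double`, `relIndex_double_ne_zero`, `relIndex_double_eq_of_antiFixed`, `chart_injOn`, `chart_mul_chart` (brings parts 1, 2a, 2b)
import HarnessLib

/-!
# R90-TF · S4 (Ch. 13.1–2) · road (J̃♭) «TWISTED TUBE JACOBIAN», FILE (TJ6) «HERBRAND WINDOW», part 3a: THE INDEX IDENTITY OF THE WINDOW

Cell `hodgecm-mathlib`, crux H413 (`stmt-HodgeConjecture-24833`, lane `--supports … --as helper`), route of record `HCCMUnconditional` (no route verbs;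
count-neutral).  Programme R90-TF, section S4 = [Rogawski1990] Ch. 13.1–13.2 (twisted Weyl integration formula, §12.5 p. 186); seat R90-C131-p02 (g2) =
(TJ6) pen; ORDER = S4 dealer K2E2-plan (g8) S4-R59 (4), spec S4-R63 (K2E3-p03 (g10)'s `h♮` binder of ★ `twistedTubeJacobian_of_local`), cut S4-R67∕S4-R80:
FILE 3b ★ p865049 `herbrandWindow_of_index` (K2E3-p03) turns the INDEX IDENTITY `hidx : [K_W : cW] = [F_W : NW]` + the pin into `h♮`; FILE 3c
(`R90S4TwistedHerbrandWindowData`, C131-p04 (g3)) builds the four window-subgroup families with their membership letters; THIS FILE proves `hidx`.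

THE FRAME = (TJ5-abs) ∪ the MATRIX chart of the model (★ `exists_glChart`: `c : M_m(K) → G`, `ρG (c X) = cayley X` on the ball `X ≤ α`):
an abelian closed `A ≤ G` (`T̃`) with the twist `ε : G →* G` (`ε A ⊆ A`, `ε ∘ ε = id` on `A`), the fixed subgroup `P′ = A^ε` (letter `hP'ε`), the norm
`φ : ↥A →* P` read through the pin `e : P ≃* ↥P′`, `e(φ w) = w·ε(w)`; the commutative inverse-closed closed subalgebra `𝔞 ⊆ M_m(K)` with `c X ∈ A ↔ X ∈ 𝔞` on
the ball; the slot map `E` (additive anti-involution, level preserving) with `ρG(ε(c X))⁻¹ = cayley (E X)`; an anti-fixed scalar `θ` (`E (θ•X) = −θ•E X`,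
`0 < |θ| ≤ 1`); the windows `W j ≤ A` with `a ∈ W j ↔ ∃ X ≤ α^(j+1), c X = a`; and the four window subgroups `K_W = ker φ ∩ W`, `cW = {w ε(w)⁻¹}`,
`F_W = P′ ∩ W`, `NW = {w ε(w)}` by ★ FILE 3b's membership letters `hKW hcW hFW hNW`.

THE RESULT: **`herbrandWindow_index`** — for EVERY `j`, **`[K_W : cW] = [F_W : NW]`** and `[K_W : cW] ≠ 0` (as `(cW j).relIndex (KW j) = (NW j).relIndex (FW j)`,
`≠ 0`).  Route (census `R90/R90-C131-p02/g2/CENSUS-TJ6.md` §1): inside the window group `B = ↥(W j)` with `D b = b ε(b)⁻¹`, `N b = b ε(b)`, `sq b = b²`,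
★ part 1 gives `[ker N : ker N²]·[ker D : N B] = [ker D : (ker D)²]·[ker N : D B]`; the chart identifies `ker N = c(M⁺ j)` (`E X = X`) and `ker D = c(M⁻ j)`
(`E X = −X`) (`ε(c X) = c(−E X)`, `(c X)⁻¹ = c(−X)`, chart injectivity), so ★ part 2c gives `[ker N : ker N²] = [M⁺ j : 2M⁺ j]`, `[ker D : (ker D)²] = [M⁻ j : 2M⁻ j]`,
equal and non-zero by `θ`-transport; finally the subgroup calculus (`relIndex_comap`, `relIndex_map_map_of_injective`) moves the identity from `B` to `ker φ` and `P′`.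

HONEST LABEL: HC_CM is proved only modulo the 7 printed citations (2 remaining named inputs: hLiu418 = `stmt-HodgeConjecture-24832`, h413 =
`stmt-HodgeConjecture-24833`) until rung 0 closes; this file closes no socket (REL ≠ ★ ≠ BUILT; count-neutral).

## References
* [Serre1979] J.-P. Serre, *Local Fields*, GTM 67 (1979), VIII §4 (Herbrand quotient). Context locator.
* [Rogawski1990] J. D. Rogawski, *Automorphic Representations of Unitary Groups in Three Variables*, Ann. of Math. Stud. 123 (1990), §3.11 Prop. 3.11.1, §12.5 p. 186. Context locator.
* [PlatonovRapinchuk1994] V. Platonov, A. Rapinchuk, *Algebraic Groups and Number Theory* (1994), §3.3 (Cayley map, congruence subgroups). Context locator.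
-/

set_option autoImplicit false
-- the mandated namespace repeats the single-problem summit's segment (`HodgeConjecture.HodgeConjecture`)
set_option linter.dupNamespace false

open Set Matrix ValuativeRel
open Literature.NumberTheory.Automorphic Literature.NumberTheory.Weil1982.UnitaryFinTopForm
open scoped MatrixGroups

namespace Summit.HodgeConjecture.HodgeConjecture.R90.S4

section Chart

variable {G : Type*} [Group G] (ε : G →* G)
  {K : Type*} [Field K] [ValuativeRel K] {m : Type*} [Fintype m] [DecidableEq m]
  (ρG : G →* GL m K) (hρinj : Function.Injective ρG) (c : Matrix m m K → G) {α : ValueGroupWithZero K} (hα1 : α < 1) (h2 : (2 : K) ≠ 0)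
  (hc : ∀ X, ValBound α X → ((ρG (c X) : GL m K) : Matrix m m K) = cayley X)
  (E : Matrix m m K →+ Matrix m m K) (hE : ∀ (γ : ValueGroupWithZero K) (W : Matrix m m K), ValBound γ W → ValBound γ (E W))
  (hε : ∀ X, ValBound α X → (((ρG (ε (c X)))⁻¹ : GL m K) : Matrix m m K) = cayley (E X))

include hρinj hc in
/-- The chart sends `0` to `1`. [cite: PlatonovRapinchuk1994, §3.3] -/
theorem chart_zero_eq_one : c 0 = 1 := by
  apply hρinj
  apply Units.ext
  rw [hc 0 (valBound_zero α), map_one, Units.val_one, cayley_def, add_zero, sub_zero, inv_one, mul_one]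

include hρinj hc hα1 in
/-- **Inversion in the chart**: `(c X)⁻¹ = c(−X)` on the ball (`c(X)·c(−X) = c(S(X, −X)) = c 0 = 1`). [cite: Serre1992LALG, Part II Ch. IV §8] [cite: PlatonovRapinchuk1994, §3.3] -/
theorem chart_neg {X : Matrix m m K} (hX : ValBound α X) : c (-X) = (c X)⁻¹ := by
  symm
  rw [inv_eq_iff_mul_eq_one, chart_mul_chart hα1 ρG hρinj c hc hX hX.neg (by rw [mul_neg, neg_mul]), add_neg_cancel, zero_mul]
  exact chart_zero_eq_one ρG hρinj c hc

include hρinj hc hα1 hE hε in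
/-- **The twist in the chart**: `ε(c X) = c(−E X)` on the ball (`ρG(ε(c X))⁻¹ = cayley (E X)`, `cayley(−Y)·cayley(Y) = 1`). [cite: Rogawski1990, §12.5 p. 186]
[cite: PlatonovRapinchuk1994, §3.3] -/
theorem eps_chart {X : Matrix m m K} (hX : ValBound α X) : ε (c X) = c (-(E X)) := by
  have hEX : ValBound α (E X) := hE α X hX
  obtain ⟨hm, -, -⟩ := isUnit_det_one_sub_of_valBound hEX hα1
  obtain ⟨hp, -, -⟩ := isUnit_det_one_add_of_valBound hEX hα1
  apply hρinj
  rw [← _root_.inv_inj]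
  apply Units.ext
  rw [hε X hX, Matrix.coe_units_inv, hc _ hEX.neg]
  exact (Matrix.inv_eq_left_inv (cayley_mul_cayley_neg hm hp)).symm

end Chart

section Index

variable {G : Type*} [Group G] (ε : G →* G) (A P' : Subgroup G) {P : Type*} [Group P] (φ : ↥A →* P)
  {K : Type*} [Field K] [ValuativeRel K] [TopologicalSpace K] [IsNonarchimedeanLocalField K] {m : Type*} [Fintype m] [DecidableEq m]
  (ρG : G →* GL m K) (hρinj : Function.Injective ρG) (c : Matrix m m K → G) {α : ValueGroupWithZero K} (hα : α ≠ 0) (hα1 : α < 1) (h2 : (2 : K) ≠ 0)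
  (hc : ∀ X, ValBound α X → ((ρG (c X) : GL m K) : Matrix m m K) = cayley X)
  (𝔞 : Subalgebra K (Matrix m m K)) (h𝔞c : ∀ X ∈ 𝔞, ∀ Y ∈ 𝔞, X * Y = Y * X) (h𝔞i : ∀ X ∈ 𝔞, IsUnit X.det → X⁻¹ ∈ 𝔞)
  (h𝔞cl : IsClosed (𝔞 : Set (Matrix m m K))) (h𝔞 : ∀ X, ValBound α X → (c X ∈ A ↔ X ∈ 𝔞))
  (E : Matrix m m K →+ Matrix m m K) (hEm : ∀ X Y, E (X * Y) = E Y * E X) (hE1 : E 1 = 1) (hEc : Continuous E)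
  (hE : ∀ (γ : ValueGroupWithZero K) (W : Matrix m m K), ValBound γ W → ValBound γ (E W))
  (hε : ∀ X, ValBound α X → (((ρG (ε (c X)))⁻¹ : GL m K) : Matrix m m K) = cayley (E X))
  {θ : K} (hθ0 : θ ≠ 0) (hθ1 : valuation K θ ≤ 1) (hEθ : ∀ X, E (θ • X) = -(θ • E X))
  (hAc : ∀ x ∈ A, ∀ y ∈ A, x * y = y * x) (hεA : ∀ x ∈ A, ε x ∈ A) (hεε : ∀ x ∈ A, ε (ε x) = x) (hP'A : P' ≤ A)
  (hP'ε : ∀ a ∈ A, a ∈ P' ↔ ε a = a)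
  (e : P ≃* ↥P') (hφe : ∀ w : ↥A, ((e (φ w) : ↥P') : G) = (w : G) * ε w)
  (W : ℕ → Subgroup ↥A) (hW : ∀ (j : ℕ) (a : ↥A), a ∈ W j ↔ ∃ X, ValBound (α ^ (j + 1)) X ∧ c X = a)
  (KW cW : ℕ → Subgroup ↥φ.ker) (FW NW : ℕ → Subgroup ↥P')
  (hKW : ∀ (j : ℕ) (k : ↥φ.ker), k ∈ KW j ↔ (k : ↥A) ∈ W j)
  (hcW : ∀ (j : ℕ) (k : ↥φ.ker), k ∈ cW j ↔ ∃ w ∈ W j, (((k : ↥A)) : G) = (w : G) * (ε w)⁻¹)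
  (hFW : ∀ (j : ℕ) (p : ↥P'), p ∈ FW j ↔ (p : G) ∈ Subtype.val '' (W j : Set ↥A))
  (hNW : ∀ (j : ℕ) (p : ↥P'), p ∈ NW j ↔ ∃ w ∈ W j, (p : G) = (w : G) * ε w)

include hφe in
omit [TopologicalSpace K] [IsNonarchimedeanLocalField K] in
/-- `ker φ` through the pin: `φ w = 1 ↔ w·ε(w) = 1`. [cite: Rogawski1990, §3.11 Prop. 3.11.1] -/
theorem map_eq_one_iff_mul_eps (w : ↥A) : φ w = 1 ↔ (w : G) * ε w = 1 := by
  rw [← hφe w, ← e.map_eq_one_iff (x := φ w)]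
  constructor
  · intro h; rw [h]; rfl
  · intro h; exact Subtype.ext h

include hρinj hc hα hα1 h2 h𝔞c h𝔞i h𝔞cl h𝔞 hEm hE1 hEc hE hε hθ0 hθ1 hEθ hAc hεA hεε hP'ε hφe hW hKW hcW hFW hNW in
/-- **THE INDEX IDENTITY OF THE CAYLEY WINDOW** (`hidx` of ★ FILE 3b `herbrandWindow_of_index`, with its finiteness): for every `j`,
**`[K_W : cW] = [F_W : NW]`** and `[K_W : cW] ≠ 0` — the Herbrand quotient `h(⟨ε⟩, W_j) = |Ĥ⁰|⁄|Ĥ⁻¹| = 1` of the compact open window `W_j = T̃ ∩ c(Λ_j)`.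
Inside `B = ↥(W j)`: ★ part 1's involution identity for `D = (1−ε)`, `N = (1+ε)`, `sq`; `ker N = c(M⁺ j)`, `ker D = c(M⁻ j)` through the chart (`ε(c X) = c(−E X)`);
★ part 2c: `[ker N : (ker N)²] = [M⁺ j : 2M⁺ j] = [M⁻ j : 2M⁻ j] = [ker D : (ker D)²] ≠ 0` (`θ`-transport); cancellation; transport to `ker φ` and `P′` along the subtype maps.
[cite: Serre1979, VIII §4 Props. 7–8] [cite: Rogawski1990, §3.11 Prop. 3.11.1, §12.5 p. 186] -/
theorem herbrandWindow_index (j : ℕ) :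
    (cW j).relIndex (KW j) = (NW j).relIndex (FW j) ∧ (cW j).relIndex (KW j) ≠ 0 := by
  classical
  have hαj : α ^ (j + 1) ≤ α := by simpa using pow_le_pow_right_of_le_one' hα1.le (show 1 ≤ j + 1 by omega)
  -- ### (0) the chart letters on the window
  have hchart : ∀ {a : ↥A}, a ∈ W j → ∃ X, ValBound (α ^ (j + 1)) X ∧ X ∈ 𝔞 ∧ c X = a := by
    intro a ha
    obtain ⟨X, hX, hXa⟩ := (hW j a).1 ha
    exact ⟨X, hX, (h𝔞 X (hX.mono hαj)).1 (hXa ▸ a.2), hXa⟩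
  have hεc : ∀ {X}, ValBound α X → ε (c X) = c (-(E X)) := fun hX => eps_chart ε ρG hρinj c hα1 hc E hE hε hX
  have hinvc : ∀ {X}, ValBound α X → (c X)⁻¹ = c (-X) := fun hX => (chart_neg ρG hρinj c hα1 hc hX).symm
  have hinj : ∀ {X Y}, ValBound α X → ValBound α Y → c X = c Y → X = Y := fun hX hY h => chart_injOn hα1 h2 ρG c hc hX hY h
  -- `ε` preserves the window
  have hWε : ∀ (a : ↥A), a ∈ W j → (⟨ε a, hεA a a.2⟩ : ↥A) ∈ W j := by
    intro a ha
    obtain ⟨X, hX, -, hXa⟩ := hchart ha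
    exact (hW j _).2 ⟨-(E X), (hE _ X hX).neg, by rw [← hεc (hX.mono hαj), hXa]⟩
  -- ### (1) the window group `B` and its three letters
  let εA : ↥A →* ↥A := MonoidHom.mk' (fun a => ⟨ε a, hεA a a.2⟩) (fun a b => Subtype.ext (by simp))
  have hεA_coe : ∀ a : ↥A, ((εA a : ↥A) : G) = ε a := fun a => rfl
  let εB : ↥(W j) →* ↥(W j) := (εA.restrict (W j)).codRestrict (W j) (fun b => hWε b b.2)
  have hεB_coe : ∀ b : ↥(W j), (((εB b : ↥(W j)) : ↥A) : G) = ε b := fun b => rfl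
  have hcB : ∀ x y : ↥(W j), x * y = y * x := fun x y =>
    Subtype.ext (Subtype.ext (hAc _ (x : ↥A).2 _ (y : ↥A).2))
  have heB : ∀ x : ↥(W j), εB (εB x) = x := fun x => Subtype.ext (Subtype.ext (hεε _ (x : ↥A).2))
  let D : ↥(W j) →* ↥(W j) := MonoidHom.mk' (fun b => b * (εB b)⁻¹) (fun a b => by
    rw [map_mul, _root_.mul_inv_rev, hcB (εB b)⁻¹]
    simp only [mul_assoc]
    rw [← mul_assoc b, hcB b (εB a)⁻¹, mul_assoc])
  let N : ↥(W j) →* ↥(W j) := MonoidHom.mk' (fun b => b * εB b) (fun a b => by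
    rw [map_mul]; simp only [mul_assoc]; rw [← mul_assoc b, hcB b (εB a), mul_assoc])
  let sq : ↥(W j) →* ↥(W j) := MonoidHom.mk' (fun b => b * b) (fun a b => by
    simp only [mul_assoc]; rw [← mul_assoc b a b, hcB b a, mul_assoc])
  have hD : ∀ b, D b = b * (εB b)⁻¹ := fun b => rfl
  have hN : ∀ b, N b = b * εB b := fun b => rfl
  have hsq : ∀ b, sq b = b * b := fun b => rfl
  -- ### (2) the two kernels through the chart
  have hN1 : ∀ b : ↥(W j), b ∈ N.ker ↔ ((b : ↥A) : G) * ε ((b : ↥A) : G) = 1 := by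
    intro b
    rw [MonoidHom.mem_ker, hN, Subtype.ext_iff, Subtype.ext_iff, Subgroup.coe_mul, Subgroup.coe_mul, hεB_coe]
    rfl
  have hD1 : ∀ b : ↥(W j), b ∈ D.ker ↔ ε ((b : ↥A) : G) = ((b : ↥A) : G) := by
    intro b
    rw [MonoidHom.mem_ker, hD, mul_inv_eq_one, Subtype.ext_iff, Subtype.ext_iff, hεB_coe, eq_comm]
  have hkerN : ∀ (b : ↥(W j)) {X : Matrix m m K}, ValBound α X → c X = ((b : ↥A) : G) → (b ∈ N.ker ↔ E X = X) := by
    intro b X hXα hXb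
    rw [hN1, ← hXb, hεc hXα, mul_eq_one_iff_inv_eq, hinvc hXα]
    constructor
    · intro h
      have h' := hinj hXα.neg (hE _ X hXα).neg h
      rw [neg_inj] at h'
      exact h'.symm
    · intro h
      rw [h]
  have hkerD : ∀ (b : ↥(W j)) {X : Matrix m m K}, ValBound α X → c X = ((b : ↥A) : G) → (b ∈ D.ker ↔ E X = -X) := by
    intro b X hXα hXb
    rw [hD1, ← hXb, hεc hXα]
    constructor
    · intro h
      have h' := hinj (hE _ X hXα).neg hXα h
      calc E X = -(-(E X)) := (neg_neg _).symm
        _ = -X := by rw [h']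
    · intro h
      rw [h, neg_neg]
  -- ### (3) the eigen-lattices `M⁺`, `M⁻` and the doubling letter
  have mkM : ∀ s : K, ∃ M : ℕ → AddSubgroup (Matrix m m K), ∀ i X, X ∈ M i ↔ (ValBound (α ^ (i + 1)) X ∧ X ∈ 𝔞 ∧ E X = s • X) := by
    intro s
    refine ⟨fun i => { carrier := {X | ValBound (α ^ (i + 1)) X ∧ X ∈ 𝔞 ∧ E X = s • X}, add_mem' := ?_, zero_mem' := ?_, neg_mem' := ?_ },
      fun i X => Iff.rfl⟩
    · rintro a b ⟨ha, ha', hEa⟩ ⟨hb, hb', hEb⟩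
      exact ⟨ha.add hb, 𝔞.add_mem ha' hb', by rw [map_add, hEa, hEb, smul_add]⟩
    · exact ⟨valBound_zero _, 𝔞.zero_mem, by rw [map_zero, smul_zero]⟩
    · rintro a ⟨ha, ha', hEa⟩
      exact ⟨ha.neg, 𝔞.neg_mem ha', by rw [map_neg, hEa, smul_neg]⟩
  obtain ⟨Mp, hMp⟩ := mkM 1
  obtain ⟨Mn, hMn⟩ := mkM (-1)
  let db : Matrix m m K →+ Matrix m m K := AddMonoidHom.id _ + AddMonoidHom.id _
  have hdb : ∀ X, db X = X + X := fun X => rfl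
  -- ### (4) the two kernels as chart images in `G`, and ★ part 2c
  let ιG : ↥(W j) →* G := A.subtype.comp (W j).subtype
  have hιG : ∀ b : ↥(W j), ιG b = ((b : ↥A) : G) := fun b => rfl
  have hιGinj : Function.Injective ιG := fun x y h => Subtype.ext (Subtype.ext h)
  have hmemW : ∀ {X}, ValBound (α ^ (j + 1)) X → X ∈ 𝔞 → ∃ b : ↥(W j), c X = ((b : ↥A) : G) := by
    intro X hX hX𝔞
    have hXA : c X ∈ A := (h𝔞 X (hX.mono hαj)).2 hX𝔞
    exact ⟨⟨⟨c X, hXA⟩, (hW j _).2 ⟨X, hX, rfl⟩⟩, rfl⟩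
  have hHp : ∀ g, g ∈ N.ker.map ιG ↔ ∃ X ∈ Mp j, c X = g := by
    intro g
    rw [Subgroup.mem_map]
    constructor
    · rintro ⟨b, hb, rfl⟩
      obtain ⟨X, hX, hX𝔞, hXb⟩ := hchart b.2
      exact ⟨X, (hMp j X).2 ⟨hX, hX𝔞, by rw [(hkerN b (hX.mono hαj) hXb).1 hb, one_smul]⟩, hXb⟩
    · rintro ⟨X, hXM, hXg⟩
      obtain ⟨hX, hX𝔞, hEX⟩ := (hMp j X).1 hXM
      obtain ⟨b, hXb⟩ := hmemW hX hX𝔞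
      exact ⟨b, (hkerN b (hX.mono hαj) hXb).2 (by rw [hEX, one_smul]), by rw [hιG, ← hXb]; exact hXg⟩
  have hHn : ∀ g, g ∈ D.ker.map ιG ↔ ∃ X ∈ Mn j, c X = g := by
    intro g
    rw [Subgroup.mem_map]
    constructor
    · rintro ⟨b, hb, rfl⟩
      obtain ⟨X, hX, hX𝔞, hXb⟩ := hchart b.2
      exact ⟨X, (hMn j X).2 ⟨hX, hX𝔞, by rw [(hkerD b (hX.mono hαj) hXb).1 hb, neg_one_smul]⟩, hXb⟩
    · rintro ⟨X, hXM, hXg⟩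
      obtain ⟨hX, hX𝔞, hEX⟩ := (hMn j X).1 hXM
      obtain ⟨b, hXb⟩ := hmemW hX hX𝔞
      exact ⟨b, (hkerD b (hX.mono hαj) hXb).2 (by rw [hEX, neg_one_smul]), by rw [hιG, ← hXb]; exact hXg⟩
  have hH2 : ∀ (L : Subgroup ↥(W j)) (g : G), g ∈ (L.map sq).map ιG ↔ ∃ h ∈ L.map ιG, h * h = g := by
    intro L g
    simp only [Subgroup.mem_map]
    constructor
    · rintro ⟨_, ⟨b, hb, rfl⟩, rfl⟩
      exact ⟨ιG b, ⟨b, hb, rfl⟩, by rw [hsq, map_mul]⟩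
    · rintro ⟨_, ⟨b, hb, rfl⟩, rfl⟩
      exact ⟨sq b, ⟨b, hb, rfl⟩, by rw [hsq, map_mul]⟩
  have hs1 : (1 : K) * 1 = 1 := one_mul 1
  have hs1' : (-1 : K) * (-1) = 1 := by rw [neg_mul_neg, one_mul]
  have hIp : (N.ker.map sq).relIndex N.ker = ((Mp j).map db).relIndex (Mp j) := by
    rw [← Subgroup.relIndex_map_map_of_injective (f := ιG) (N.ker.map sq) N.ker hιGinj]
    exact relIndex_sq_chart_eq_relIndex_double 𝔞 h𝔞c h𝔞i h𝔞cl E hEm hE1 hEc hs1 hα hα1 h2 Mp hMp db hdb ρG hρinj c hc j _ _ hHp (hH2 N.ker)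
  have hIn : (D.ker.map sq).relIndex D.ker = ((Mn j).map db).relIndex (Mn j) := by
    rw [← Subgroup.relIndex_map_map_of_injective (f := ιG) (D.ker.map sq) D.ker hιGinj]
    exact relIndex_sq_chart_eq_relIndex_double 𝔞 h𝔞c h𝔞i h𝔞cl E hEm hE1 hEc hs1' hα hα1 h2 Mn hMn db hdb ρG hρinj c hc j _ _ hHn (hH2 D.ker)
  have hKF : (N.ker.map sq).relIndex N.ker = (D.ker.map sq).relIndex D.ker := by
    rw [hIp, hIn]
    exact relIndex_double_eq_of_antiFixed 𝔞 h𝔞cl E hEc hα hα1 h2 Mp Mn hMp hMn db hdb hθ0 hθ1 hEθ j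
  have h0 : (N.ker.map sq).relIndex N.ker ≠ 0 := by
    rw [hIp]
    exact relIndex_double_ne_zero 𝔞 h𝔞cl E hEc hα hα1 h2 Mp hMp db hdb j
  -- ### (5) ★ part 1: the involution index identity, cancelled
  have hB : D.range.relIndex N.ker = N.range.relIndex D.ker := relIndex_range_eq_of_relIndex_sq_eq hcB εB D N sq heB hD hN hsq hKF h0
  have hB0 : D.range.relIndex N.ker ≠ 0 := fun h =>
    h0 (Subgroup.relIndex_eq_zero_of_le_left (map_sq_ker_norm_le_range εB D N sq hD hN hsq) h)
  -- ### (6) transport to `ker φ` and `P′`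
  let f : ↥φ.ker →* ↥A := φ.ker.subtype
  let ι : ↥(W j) →* ↥A := (W j).subtype
  have hφker : ∀ a : ↥A, a ∈ φ.ker ↔ (a : G) * ε a = 1 := fun a => by
    rw [MonoidHom.mem_ker]; exact map_eq_one_iff_mul_eps ε A P' φ e hφe a
  have hKWeq : KW j = (W j).comap f := by
    ext k; rw [hKW, Subgroup.mem_comap]; rfl
  have hcWeq : cW j = (D.range.map ι).comap f := by
    ext k
    rw [hcW, Subgroup.mem_comap, Subgroup.mem_map]
    constructor
    · rintro ⟨w, hw, hk⟩
      refine ⟨D ⟨w, hw⟩, ⟨⟨w, hw⟩, rfl⟩, Subtype.ext ?_⟩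
      show (((D ⟨w, hw⟩ : ↥(W j)) : ↥A) : G) = ((k : ↥A) : G)
      rw [hk, hD, Subgroup.coe_mul, Subgroup.coe_inv, Subgroup.coe_mul, Subgroup.coe_inv, hεB_coe]
    · rintro ⟨_, ⟨b, rfl⟩, hb⟩
      refine ⟨b, b.2, ?_⟩
      have hb' := congrArg (fun a : ↥A => (a : G)) hb
      rw [← show ((ι (D b) : ↥A) : G) = (b : G) * (ε b)⁻¹ by
        rw [hD]; show (((b * (εB b)⁻¹ : ↥(W j)) : ↥A) : G) = _; rw [Subgroup.coe_mul, Subgroup.coe_inv, Subgroup.coe_mul, Subgroup.coe_inv, hεB_coe]]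
      exact hb'.symm
  have hkerW : φ.ker ⊓ W j = N.ker.map ι := by
    ext a
    rw [Subgroup.mem_inf, Subgroup.mem_map]
    constructor
    · rintro ⟨ha1, ha2⟩
      exact ⟨⟨a, ha2⟩, (hN1 ⟨a, ha2⟩).2 ((hφker a).1 ha1), rfl⟩
    · rintro ⟨b, hb, rfl⟩
      exact ⟨(hφker _).2 ((hN1 b).1 hb), b.2⟩
  have h1 : (cW j).relIndex (KW j) = D.range.relIndex N.ker := by
    rw [hcWeq, hKWeq, Subgroup.relIndex_comap, Subgroup.map_comap_eq, Subgroup.range_subtype, hkerW,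
      Subgroup.relIndex_map_map_of_injective _ _ (W j).subtype_injective]
  let g : ↥P' →* G := P'.subtype
  have hFWeq : FW j = ((W j).map A.subtype).comap g := by
    ext p
    rw [hFW, Subgroup.mem_comap, Subgroup.mem_map]
    constructor
    · rintro ⟨a, ha, hap⟩; exact ⟨a, ha, hap⟩
    · rintro ⟨a, ha, hap⟩; exact ⟨a, ha, hap⟩
  have hNWeq : NW j = (N.range.map ιG).comap g := by
    ext p
    rw [hNW, Subgroup.mem_comap, Subgroup.mem_map]
    constructor
    · rintro ⟨w, hw, hp⟩
      refine ⟨N ⟨w, hw⟩, ⟨⟨w, hw⟩, rfl⟩, ?_⟩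
      rw [hιG, hN, Subgroup.coe_mul, Subgroup.coe_mul, hεB_coe]
      exact hp.symm
    · rintro ⟨_, ⟨b, rfl⟩, hb⟩
      refine ⟨b, b.2, ?_⟩
      have hb' : ιG (N b) = (p : G) := hb
      rw [← hb', hιG, hN, Subgroup.coe_mul, Subgroup.coe_mul, hεB_coe]
  have hfixW : P' ⊓ (W j).map A.subtype = D.ker.map ιG := by
    ext x
    rw [Subgroup.mem_inf, Subgroup.mem_map, Subgroup.mem_map]
    constructor
    · rintro ⟨hxP, a, ha, rfl⟩
      exact ⟨⟨a, ha⟩, (hD1 ⟨a, ha⟩).2 ((hP'ε _ a.2).1 hxP), rfl⟩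
    · rintro ⟨b, hb, rfl⟩
      exact ⟨(hP'ε _ (b : ↥A).2).2 ((hD1 b).1 hb), (b : ↥A), b.2, rfl⟩
  have h2' : (NW j).relIndex (FW j) = N.range.relIndex D.ker := by
    rw [hNWeq, hFWeq, Subgroup.relIndex_comap, Subgroup.map_comap_eq, Subgroup.range_subtype, hfixW,
      Subgroup.relIndex_map_map_of_injective _ _ hιGinj]
  exact ⟨by rw [h1, h2', hB], by rw [h1]; exact hB0⟩

end Index

end Summit.HodgeConjecture.HodgeConjecture.R90.S4
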